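import Summits.CriticalPhenomena.PercolationContinuityZ3.Theorems.PercNearOneGluingNoHeavyLowerTailSahiMixtureHereditaryCex53Law
import Summits.CriticalPhenomena.PercolationContinuityZ3.Theorems.PercNearOneGluingNoHeavyLowerTailSahiMixtureIrredundant

/-!
# The (5,3) singleton witness, II: the quintuple `A_i = {C ∋ i}` is hereditarily all-orders positive — uncovered reduction, private coordinates, `decide`

Support file of the one-cut programme (crux `NoHeavyLowerTail`, stmt-CriticalPhenomena-4575; cell `prim-masterthm`, seat P3, gen 10; HIERARCHY §18).  Second of three
files (`…Cex53Law`, this, `…SingletonFiveThree`).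
HEREDITARITY (`hereditaryAllOrders_upEv5`, hence **`hereditaryAllOrders_cex53`**: `cex53A ∈ 𝒦_5`).  By P3's uncovered reduction (`sahiE_nonneg_of_uncovered`,
`…SahiMixtureIrredundant`) only slot maps in which no slot's up-set contains the intersection of the others matter; such a slot map gives every slot a coordinate in
which it is the STRICT UNIQUE MAXIMUM (`exists_coord_of_uncovered5`), the private coordinates are injective (`exists_private_of_uncovered5`), so `m ≤ 5`
(`card_le_five_of_uncovered5`); for `m = 5` the slots ARE the five generators up to order (`exists_perm_sng_of_uncovered5`; one integer `E5Z5_sng_nonneg =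
65536⁵·E_5(A) = 94421403133606637952 ≥ 0`), for `m = 4` they are `{x.succAbove a} ∪ D_a`, `D_a ⊆ {x}`, up to order, `x` the coordinate private to no slot
(`exists_perm_mk_of_uncovered5`; 80 integers `E4Z5_mk_nonneg`), and for `m ≤ 3` all `32³ + 32²` ordered rows are checked (`E3Z5_nonneg` — the one expensive
`decide`, `maxHeartbeats 8000000` — and `E2Z5_nonneg`).  Sahi's symmetry `sahiE_comp_perm` does the reordering.  `decide +kernel`, standard axioms.
(Outside the kernel: all 781 irredundant rows are `≥ 549/536870912`, HMIX5-SINGLETON-WITNESS.md.)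
HONEST FRAMING: a membership certificate for one law; nothing here bears on the comb / product-measure level or on Sahi's `C_k`. [this work]
-/

namespace Summit.CriticalPhenomena.PercolationContinuityZ3.Theorems

open Finset Function
open Literature.Combinatorics.Sahi2008
open Literature.Probability.Percolation.DecisionTree (ind ind_of_mem ind_of_not_mem ind_nonneg)

namespace SahiMixture

/-! ### The finite checks -/

/-- **All 1024 ordered covariances of principal up-sets are `≥ 0`.** [this work] -/
theorem E2Z5_nonneg : ∀ a0 a1 a2 a3 a4 b0 b1 b2 b3 b4 : Fin 2, 0 ≤ E2Z5 ![a0, a1, a2, a3, a4] ![b0, b1, b2, b3, b4] := by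
  decide +kernel

set_option maxHeartbeats 8000000 in
/-- **All 32 768 ordered cubic rows of principal up-sets are `≥ 0`** (the one expensive finite check). [this work] -/
theorem E3Z5_nonneg : ∀ a0 a1 a2 a3 a4 b0 b1 b2 b3 b4 c0 c1 c2 c3 c4 : Fin 2,
    0 ≤ E3Z5 ![a0, a1, a2, a3, a4] ![b0, b1, b2, b3, b4] ![c0, c1, c2, c3, c4] := by
  decide +kernel

/-- **The 80 quartic rows with slots `{x.succAbove a} ∪ D_a`, `D_a ⊆ {x}`, are `≥ 0`** (the uncovered quartic rows up to order). [this work] -/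
theorem E4Z5_mk_nonneg : ∀ (x : Fin 5) (d0 d1 d2 d3 : Fin 2),
    0 ≤ E4Z5 (mk5 (x.succAbove 0) d0 x) (mk5 (x.succAbove 1) d1 x) (mk5 (x.succAbove 2) d2 x) (mk5 (x.succAbove 3) d3 x) := by
  decide +kernel

/-- **The quintic row of the five generators is `≥ 0`** (`65536⁵·E_5(A) = 94421403133606637952`). [this work] -/
theorem E5Z5_sng_nonneg : 0 ≤ E5Z5 (sng 0) (sng 1) (sng 2) (sng 3) (sng 4) := by
  decide +kernel

/-! ### Uncovered slot maps of principal up-sets: private coordinates -/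

/-- In `Fin 2`, `u < v` forces `v = 1`, `u = 0`. [folklore] -/
theorem fin2_eq_of_lt {u v : Fin 2} (h : u < v) : v = 1 ∧ u = 0 := by
  have hu := u.isLt
  have hv := v.isLt
  rw [Fin.lt_def] at h
  constructor <;> apply Fin.ext <;> simp only [Fin.val_one, Fin.val_zero] <;> omega

/-- In an uncovered slot map of principal up-sets every slot is the strict unique maximum in some coordinate. [this work] -/
theorem exists_coord_of_uncovered5 {m : ℕ} (s : Fin m → Lv5) (hs : Uncovered upEv5 s) (a : Fin m) :
    ∃ c : Fin 5, ∀ b, b ≠ a → s b c < s a c := by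
  by_contra hne
  refine hs a fun x hx => mem_upEv5.2 fun c => ?_
  obtain ⟨b, hba, hb⟩ : ∃ b, b ≠ a ∧ s a c ≤ s b c := by
    obtain ⟨b, hb⟩ := not_forall.1 ((not_exists.1 hne) c)
    exact ⟨b, (Classical.not_imp.1 hb).1, not_lt.1 (Classical.not_imp.1 hb).2⟩
  have hxb : x ∈ upEv5 (s b) :=
    Set.mem_iInter₂.1 hx b (Finset.mem_erase.2 ⟨hba, Finset.mem_univ b⟩)
  exact hb.trans (mem_upEv5.1 hxb c)

/-- Private coordinates of an uncovered slot map with at least two slots: an injective choice `c`, with `s a (c a) = 1` and `s a (c b) = 0` for `b ≠ a`.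
[this work] -/
theorem exists_private_of_uncovered5 {k : ℕ} (s : Fin (k + 2) → Lv5) (hs : Uncovered upEv5 s) :
    ∃ c : Fin (k + 2) → Fin 5, Injective c ∧ (∀ a, s a (c a) = 1) ∧ ∀ a b, a ≠ b → s a (c b) = 0 := by
  choose c hc using exists_coord_of_uncovered5 s hs
  refine ⟨c, fun a b hab => ?_, fun a => ?_, fun a b hab => (fin2_eq_of_lt (hc b a hab)).2⟩
  · by_contra hne
    have h1 := hc a b (Ne.symm hne)
    have h2 := hc b a hne
    rw [hab] at h1
    exact lt_asymm h1 h2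
  · obtain ⟨b, hb⟩ := exists_ne a
    exact (fin2_eq_of_lt (hc a b hb)).1

/-- **An uncovered slot map of principal up-sets of `{0,1}^5` has at most `5` slots.** [this work] -/
theorem card_le_five_of_uncovered5 {m : ℕ} (s : Fin m → Lv5) (hs : Uncovered upEv5 s) : m ≤ 5 := by
  rcases m with _ | _ | k
  · omega
  · omega
  obtain ⟨c, hc, -, -⟩ := exists_private_of_uncovered5 s hs
  have h := Fintype.card_le_of_injective c hc
  simp only [Fintype.card_fin] at h
  omega

/-- **Five uncovered slots are the five generators, up to order.** [this work] -/
theorem exists_perm_sng_of_uncovered5 (s : Fin 5 → Lv5) (hs : Uncovered upEv5 s) :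
    ∃ ρ : Equiv.Perm (Fin 5), ∀ a, s a = sng (ρ a) := by
  obtain ⟨c, hc, h1, h0⟩ := exists_private_of_uncovered5 s hs
  have hbij : Bijective c := Finite.injective_iff_bijective.1 hc
  refine ⟨Equiv.ofBijective c hbij, fun a => ?_⟩
  funext j
  show s a j = (if j = c a then 1 else 0)
  by_cases hj : j = c a
  · rw [if_pos hj, hj, h1]
  · rw [if_neg hj]
    obtain ⟨b, hb⟩ := hbij.2 j
    have hab : a ≠ b := fun h => hj (by rw [← hb, h])
    rw [← hb, h0 a b hab]

/-- **Four uncovered slots are `{x.succAbove a} ∪ D_a`, `D_a ⊆ {x}`, up to order**, where `x` is the coordinate private to no slot. [this work] -/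
theorem exists_perm_mk_of_uncovered5 (s : Fin 4 → Lv5) (hs : Uncovered upEv5 s) :
    ∃ (x : Fin 5) (ρ : Equiv.Perm (Fin 4)) (d : Fin 4 → Fin 2), ∀ a, s a = mk5 (x.succAbove (ρ a)) (d (ρ a)) x := by
  obtain ⟨c, hc, h1, h0⟩ := exists_private_of_uncovered5 s hs
  -- the coordinate missed by `c`
  obtain ⟨x, hx⟩ : ∃ x, ∀ a, c a ≠ x := by
    by_contra h
    simp only [not_exists, not_forall, ne_eq, not_not] at h
    have hle : Fintype.card (Fin 5) ≤ Fintype.card (Fin 4) := Fintype.card_le_of_surjective c fun x => h x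
    simp at hle
  -- `c = x.succAbove ∘ τ` with `τ` a permutation
  have hτ : ∀ a, ∃ z : Fin 4, x.succAbove z = c a := fun a => Fin.exists_succAbove_eq (hx a)
  choose τ hτ using hτ
  have hτinj : Injective τ := fun a b hab => hc (by rw [← hτ a, ← hτ b, hab])
  have hτbij : Bijective τ := Finite.injective_iff_bijective.1 hτinj
  refine ⟨x, Equiv.ofBijective τ hτbij, fun z => s ((Equiv.ofBijective τ hτbij).symm z) x, fun a => ?_⟩
  have hd : s ((Equiv.ofBijective τ hτbij).symm (τ a)) x = s a x := by
    rw [Equiv.ofBijective_symm_apply_apply]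
  funext j
  show s a j = (if j = x.succAbove (τ a) then 1 else if j = x then s ((Equiv.ofBijective τ hτbij).symm (τ a)) x else 0)
  rw [hd, hτ a]
  by_cases hj : j = c a
  · rw [if_pos hj, hj, h1]
  · rw [if_neg hj]
    by_cases hjx : j = x
    · rw [if_pos hjx, hjx]
    · rw [if_neg hjx]
      obtain ⟨z, hz⟩ := Fin.exists_succAbove_eq hjx
      obtain ⟨b, hb⟩ := hτbij.2 z
      have hjb : j = c b := by rw [← hτ b, hb, hz]
      have hab : a ≠ b := fun h => hj (by rw [hjb, h])
      rw [hjb, h0 a b hab]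

/-! ### Every row of principal up-sets is nonnegative -/

/-- Rows of order `≤ 3` of principal up-sets are nonnegative (all ordered rows checked). [this work] -/
theorem sahiE_upEv5_nonneg_of_le_three {m : ℕ} (hm : m ≤ 3) (s : Fin m → Lv5) :
    0 ≤ sahiE cex53Weight m (fun j => ind (upEv5 (s j))) := by
  interval_cases m
  · rw [sahiE_zero]
  · rw [sahiE_one_apply]
    exact ex_nonneg cex53Weight_nonneg fun x => ind_nonneg _ x
  · rw [sahiE_two_upEv5]
    have h := E2Z5_nonneg (s 0 0) (s 0 1) (s 0 2) (s 0 3) (s 0 4) (s 1 0) (s 1 1) (s 1 2) (s 1 3) (s 1 4)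
    have e0 : (![s 0 0, s 0 1, s 0 2, s 0 3, s 0 4] : Lv5) = s 0 := by funext i; fin_cases i <;> rfl
    have e1 : (![s 1 0, s 1 1, s 1 2, s 1 3, s 1 4] : Lv5) = s 1 := by funext i; fin_cases i <;> rfl
    rw [e0, e1] at h
    exact div_nonneg (Int.cast_nonneg h) (by norm_num)
  · rw [sahiE_three_upEv5]
    have h := E3Z5_nonneg (s 0 0) (s 0 1) (s 0 2) (s 0 3) (s 0 4) (s 1 0) (s 1 1) (s 1 2) (s 1 3) (s 1 4)
      (s 2 0) (s 2 1) (s 2 2) (s 2 3) (s 2 4)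
    have e0 : (![s 0 0, s 0 1, s 0 2, s 0 3, s 0 4] : Lv5) = s 0 := by funext i; fin_cases i <;> rfl
    have e1 : (![s 1 0, s 1 1, s 1 2, s 1 3, s 1 4] : Lv5) = s 1 := by funext i; fin_cases i <;> rfl
    have e2 : (![s 2 0, s 2 1, s 2 2, s 2 3, s 2 4] : Lv5) = s 2 := by funext i; fin_cases i <;> rfl
    rw [e0, e1, e2] at h
    exact div_nonneg (Int.cast_nonneg h) (by norm_num)

/-- Uncovered quartic rows of principal up-sets are nonnegative (reorder to the 80 checked rows). [this work] -/
theorem sahiE_four_upEv5_nonneg_of_uncovered (s : Fin 4 → Lv5) (hs : Uncovered upEv5 s) :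
    0 ≤ sahiE cex53Weight 4 (fun j => ind (upEv5 (s j))) := by
  obtain ⟨x, ρ, d, hsd⟩ := exists_perm_mk_of_uncovered5 s hs
  have e : (fun j => ind (upEv5 (s j))) = fun j => (fun i => ind (upEv5 (mk5 (x.succAbove i) (d i) x))) (ρ j) := by
    funext j; simp only [hsd j]
  rw [e, sahiE_comp_perm cex53Weight 4 ρ (fun i => ind (upEv5 (mk5 (x.succAbove i) (d i) x))), sahiE_four_upEv5]
  exact div_nonneg (Int.cast_nonneg (E4Z5_mk_nonneg x (d 0) (d 1) (d 2) (d 3))) (by norm_num)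

/-- Uncovered quintic rows of principal up-sets are nonnegative (reorder to the generators). [this work] -/
theorem sahiE_five_upEv5_nonneg_of_uncovered (s : Fin 5 → Lv5) (hs : Uncovered upEv5 s) :
    0 ≤ sahiE cex53Weight 5 (fun j => ind (upEv5 (s j))) := by
  obtain ⟨ρ, hsd⟩ := exists_perm_sng_of_uncovered5 s hs
  have e : (fun j => ind (upEv5 (s j))) = fun j => (fun i => ind (upEv5 (sng i))) (ρ j) := by
    funext j; simp only [hsd j]
  rw [e, sahiE_comp_perm cex53Weight 5 ρ (fun i => ind (upEv5 (sng i))), sahiE_five_upEv5]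
  exact div_nonneg (Int.cast_nonneg E5Z5_sng_nonneg) (by norm_num)

/-- **Every row (any order, any slot map) of principal up-sets of the witness law is nonnegative.** [this work] -/
theorem sahiE_upEv5_nonneg (m : ℕ) (s : Fin m → Lv5) : 0 ≤ sahiE cex53Weight m (fun j => ind (upEv5 (s j))) := by
  refine sahiE_nonneg_of_uncovered cex53Weight_nonneg sum_cex53Weight upEv5 (fun m' s' hs' => ?_) m s
  have hm := card_le_five_of_uncovered5 s' hs'
  by_cases h3 : m' ≤ 3
  · exact sahiE_upEv5_nonneg_of_le_three h3 s'
  have h45 : m' = 4 ∨ m' = 5 := by omega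
  rcases h45 with rfl | rfl
  · exact sahiE_four_upEv5_nonneg_of_uncovered s' hs'
  · exact sahiE_five_upEv5_nonneg_of_uncovered s' hs'

/-- **Any family of principal up-sets of the witness law is hereditarily all-orders positive.** [this work] -/
theorem hereditaryAllOrders_upEv5 {n : ℕ} (g : Fin n → Lv5) : HereditaryAllOrders cex53Weight (fun i => upEv5 (g i)) := by
  intro m K
  have e : (fun j => ind (⋂ i ∈ K j, upEv5 (g i))) = fun j => ind (upEv5 ((K j).sup g)) := by
    funext j; rw [biInter_upEv5]
  rw [e]
  exact sahiE_upEv5_nonneg m _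

/-- **The witness quintuple `A_i = {C ∋ i}` is hereditarily all-orders positive: `cex53A ∈ 𝒦_5`.** [this work] -/
theorem hereditaryAllOrders_cex53 : HereditaryAllOrders cex53Weight cex53A :=
  hereditaryAllOrders_upEv5 sng


end SahiMixture

end Summit.CriticalPhenomena.PercolationContinuityZ3.Theorems
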